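import Summits.PneNP.PneNP.Theorems.ExpanderLinearGeneratorsLinearGeneratorModPFregeHardMod2Count
import Literature.Computability.MetaComplexity.GaussianWidth
import Mathlib.Data.List.GetD
import HarnessLib

/-!
# `MOD₂` summation, concrete level, IV: the kinds of an unsolvable system (certificate rows and
their accumulated symmetric differences)

Support file for item `stmt-PneNP-11444` (`LinearGeneratorModPFregeHard`), calibration line "for
`p = 2` the rung fails".  The abstract chain `…Mod2Chain.lean` needs, for an unsolvable system
`E : Fin m → LinEqMod 2 n`, the following DATA: the certificate rows `row 0, …, row (q-1)` (a set
of rows summing to `0 = 1` over `𝔽₂`, Clote–Kranakis' Gaussian refutation, here from the dual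
certificate `exists_lincomb_eq_zero_one` of `GaussianWidth.lean`), their supports and right-hand
sides, and the accumulated symmetric differences of supports; packaged as one function
`Dof : ℕ → Finset ℕ` on KINDS (`2t` = accumulated set after `t` rows, `2i+1` = support of row `i`).
`exists_certificate_kinds` produces these with exactly the properties the chain consumes:
the recursion `Dof (2(t+1)) = Dof (2t) ∆ Dof (2·row t+1)`, `Dof 0 = ∅`, all sets inside `[0,n)`,
the certificate identities `Dof (2q) = ∅` and `Σ_t b_{row t} = 1`, the canonical clauses of the
rows inside `sumEncoding 1 E`, `q ≤ m`, and the counting bound `Σ_t 2^|S_{row t}| ≤ 2|φ| + m`.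

No definitions are introduced (the data are built inside the proof).

Sources: P. Clote, E. Kranakis, *Boolean Functions and Computation Models* (2002), §5.5.3;
C. Beck (2017), Def. 5.6; folklore.
-/

set_option linter.dupNamespace false -- `Summit.PneNP.PneNP.…`: summit = sub-problem (D-0017)

namespace Summit.PneNP.PneNP.Theorems.ModTwo

open Literature.Computability.Complexity Literature.Computability.MetaComplexity
open scoped symmDiff

/-! ### List bookkeeping -/

/-- A `Finset.range`-indexed sum through `getD` is the list sum. [folklore] -/
theorem sum_range_getD {β : Type*} [AddCommMonoid β] (f : ℕ → β) (d : ℕ) :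
    ∀ L : List ℕ, ∑ s ∈ Finset.range L.length, f (L.getD s d) = (L.map f).sum := by
  intro L
  induction L using List.reverseRecOn with
  | nil => simp
  | append_singleton L a ih =>
    rw [List.length_append, List.length_singleton, Finset.sum_range_succ, List.map_append,
      List.sum_append, List.map_singleton, List.sum_singleton,
      List.getD_append_right _ _ _ _ le_rfl, Nat.sub_self, List.getD_cons_zero]
    congr 1
    rw [← ih]
    refine Finset.sum_congr rfl fun s hs => ?_
    rw [List.getD_append _ _ _ _ (Finset.mem_range.1 hs)]

/-- Sum over a sorted finset as a list sum (any commutative monoid). [folklore] -/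
theorem sum_sort_map' {α β : Type*} [DecidableEq α] [LinearOrder α] [AddCommMonoid β]
    (s : Finset α) (g : α → β) : ((s.sort (· ≤ ·)).map g).sum = ∑ x ∈ s, g x := by
  rw [← List.sum_toFinset _ (Finset.sort_nodup _ _), Finset.sort_toFinset]

/-! ### The certificate and its kinds -/

/-- **Kinds of an unsolvable system.** For unsolvable `E` over `𝔽₂` there are
`Dof : ℕ → Finset ℕ`, `row : ℕ → ℕ`, `brow : ℕ → ZMod 2` and `q ≤ m` such that: the accumulated
sets obey `Dof (2(t+1)) = Dof (2t) ∆ Dof (2 row t + 1)` (`t < q`) from `Dof 0 = ∅`; all sets lie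
in `[0,n)`; the certificate closes: `Dof (2q) = ∅` while `Σ_{t<q} brow (row t) = 1`; every
wrong-parity assignment of a row's support is excluded by a clause of `sumEncoding 1 E`; and
`Σ_{t<q} 2^|Dof (2 row t + 1)| ≤ 2 |sumEncoding 1 E| + m`.
[Clote–Kranakis 2002, §5.5.3; Beck 2017, Def. 5.6] [folklore] -/
theorem exists_certificate_kinds {n m : ℕ} (E : Fin m → LinEqMod 2 n)
    (hE : ¬ SystemSat E Finset.univ) :
    ∃ (Dof : ℕ → Finset ℕ) (row : ℕ → ℕ) (brow : ℕ → ZMod 2) (q : ℕ),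
      q ≤ m ∧
      (∀ t, t < q → Dof (2 * (t + 1)) = Dof (2 * t) ∆ Dof (2 * row t + 1)) ∧
      Dof (2 * 0) = ∅ ∧
      (∀ κ, ∀ v ∈ Dof κ, v < n) ∧
      Dof (2 * q) = ∅ ∧
      (Finset.range q).sum (fun s => brow (row s)) = 1 ∧
      (∀ t, t < q → ∀ ρ : ℕ → Bool,
        (((((Dof (2 * row t + 1)).sort (· ≤ ·)).filter fun v => ρ v).length : ℕ) : ZMod 2) ≠
            brow (row t) →
          ((Dof (2 * row t + 1)).sort (· ≤ ·)).map (fun v => (v, !ρ v)) ∈ sumEncoding 1 E) ∧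
      (Finset.range q).sum (fun s => 2 ^ (Dof (2 * row s + 1)).card) ≤
        2 * (sumEncoding 1 E).length + m := by
  have key10 : ∀ b : ZMod 2, b ≠ 1 → b = 0 := by decide
  have key01 : ∀ b : ZMod 2, b ≠ 0 → b = 1 := by decide
  have hne01 : (0 : ZMod 2) ≠ 1 := by decide
  classical
  haveI : Fact (Nat.Prime 2) := ⟨Nat.prime_two⟩
  obtain ⟨v, hv⟩ := exists_lincomb_eq_zero_one E hE
  have hv1 : (lincomb v E).1 = 0 := by rw [hv]
  have hv2 : (lincomb v E).2 = 1 := by rw [hv]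
  -- the certificate rows
  set T : Finset (Fin m) := Finset.univ.filter fun i => v i = 1 with hT
  have hvT : ∀ (i : Fin m) (a : ZMod 2), v i * a = if v i = 1 then a else 0 := by
    intro i a
    by_cases h : v i = 1
    · simp [h]
    · have h0 : v i = 0 := key10 _ h
      simp [h0]
  have hsumT : ∀ (a : Fin m → ZMod 2), ∑ i, v i * a i = ∑ i ∈ T, a i := by
    intro a
    rw [hT, Finset.sum_filter]
    exact Finset.sum_congr rfl fun i _ => hvT i (a i)
  set RL : List ℕ := (T.sort (· ≤ ·)).map Fin.val with hRL
  have hRLlen : RL.length = T.card := by simp [hRL]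
  have hRLlt : ∀ i ∈ RL, i < m := by
    intro i hi
    obtain ⟨e, -, rfl⟩ := List.mem_map.1 hi
    exact e.2
  -- supports and right-hand sides as total functions on `ℕ`
  let supN : ℕ → Finset ℕ := fun i =>
    if h : i < m then ((E ⟨i, h⟩).supp).map Fin.valEmbedding else ∅
  let bN : ℕ → ZMod 2 := fun i => if h : i < m then (E ⟨i, h⟩).2 else 0
  have hsupN : ∀ e : Fin m, supN e = (E e).supp.map Fin.valEmbedding := fun e => by
    simp [supN, e.2]
  have hbN : ∀ e : Fin m, bN e = (E e).2 := fun e => by simp [bN, e.2]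
  have hsupN_lt : ∀ i, ∀ w ∈ supN i, w < n := by
    intro i w hw
    by_cases h : i < m
    · simp only [supN, h, dif_pos, Finset.mem_map, Fin.valEmbedding_apply] at hw
      obtain ⟨j, -, rfl⟩ := hw
      exact j.2
    · simp [supN, h] at hw
  let Sacc : ℕ → Finset ℕ := fun t => (RL.take t).foldl (fun acc i => acc ∆ supN i) ∅
  let Dof : ℕ → Finset ℕ := fun κ => if κ % 2 = 0 then Sacc (κ / 2) else supN (κ / 2)
  have hDa : ∀ t, Dof (2 * t) = Sacc t := fun t => by
    have h1 : 2 * t % 2 = 0 := by omega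
    have h2 : 2 * t / 2 = t := by omega
    simp only [Dof, h1, if_true, h2]
  have hDr : ∀ i, Dof (2 * i + 1) = supN i := fun i => by
    have h1 : ¬ ((2 * i + 1) % 2 = 0) := by omega
    have h2 : (2 * i + 1) / 2 = i := by omega
    simp only [Dof, h1, if_false, h2]
  let row : ℕ → ℕ := fun t => RL.getD t 0
  have hrow : ∀ t, t < RL.length → RL.getD t 0 ∈ RL := fun t ht => by
    rw [List.getD_eq_getElem _ _ ht]
    exact List.getElem_mem ht
  refine ⟨Dof, row, bN, RL.length, ?_, ?_, ?_, ?_, ?_, ?_, ?_, ?_⟩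
  · -- `q ≤ m`
    rw [hRLlen]
    exact (Finset.card_le_univ T).trans (by simp)
  · -- the recursion
    intro t ht
    rw [hDa, hDa, hDr]
    show (RL.take (t + 1)).foldl (fun acc i => acc ∆ supN i) ∅ =
      (RL.take t).foldl (fun acc i => acc ∆ supN i) ∅ ∆ supN (RL.getD t 0)
    rw [List.take_succ_eq_append_getElem ht, List.foldl_append, List.foldl_cons, List.foldl_nil,
      List.getD_eq_getElem _ _ ht]
  · -- `Dof 0 = ∅`
    rw [hDa]
    simp [Sacc]
  · -- inside `[0,n)`
    intro κ w hw
    by_cases hκ : κ % 2 = 0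
    · simp only [Dof, hκ, if_true] at hw
      have hsub := foldl_symmDiff_subset supN (Finset.range n) (RL.take (κ / 2)) ∅
        (Finset.empty_subset _) (fun i _ w hw => Finset.mem_range.2 (hsupN_lt i w hw))
      exact Finset.mem_range.1 (hsub hw)
    · simp only [Dof, hκ, if_false] at hw
      exact hsupN_lt _ w hw
  · -- the certificate closes: every variable occurs an even number of times
    rw [hDa]
    show (RL.take RL.length).foldl (fun acc i => acc ∆ supN i) ∅ = ∅
    rw [List.take_length]
    refine Finset.eq_empty_iff_forall_notMem.2 fun w hw => ?_
    rw [mem_foldl_symmDiff_iff] at hw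
    simp only [Finset.notMem_empty, if_false, zero_add, hRL, List.map_map] at hw
    rw [show ((T.sort (· ≤ ·)).map ((fun i => if w ∈ supN i then (1 : ZMod 2) else 0) ∘ Fin.val))
        = (T.sort (· ≤ ·)).map (fun e : Fin m => if w ∈ supN e then (1 : ZMod 2) else 0) from rfl,
      sum_sort_map] at hw
    by_cases hwn : w < n
    · -- the sum is the `w`-th coefficient of the certificate combination
      have hcoef : ∀ e : Fin m, (if w ∈ supN e then (1 : ZMod 2) else 0) = (E e).1 ⟨w, hwn⟩ := by
        intro e
        rw [hsupN]
        by_cases h : (⟨w, hwn⟩ : Fin n) ∈ (E e).supp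
        · have h1 : (E e).1 ⟨w, hwn⟩ ≠ 0 := by simpa [LinEqMod.supp] using h
          have h1' : (E e).1 ⟨w, hwn⟩ = 1 := key01 _ h1
          rw [h1', if_pos]
          exact Finset.mem_map.2 ⟨⟨w, hwn⟩, h, rfl⟩
        · have h0 : (E e).1 ⟨w, hwn⟩ = 0 := by simpa [LinEqMod.supp] using h
          rw [h0, if_neg]
          intro hm
          obtain ⟨j, hj, hjw⟩ := Finset.mem_map.1 hm
          have : j = ⟨w, hwn⟩ := Fin.ext (by simpa using hjw)
          exact h (this ▸ hj)
      rw [Finset.sum_congr rfl (fun e _ => hcoef e), ← hsumT (fun i => (E i).1 ⟨w, hwn⟩)] at hw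
      have := congrFun hv1 ⟨w, hwn⟩
      simp only [lincomb, Pi.zero_apply] at this
      rw [this] at hw
      exact absurd hw hne01
    · have h0 : ∀ e ∈ T, (if w ∈ supN e then (1 : ZMod 2) else 0) = 0 := by
        intro e _
        rw [if_neg]
        exact fun hm => hwn (hsupN_lt _ w hm)
      rw [Finset.sum_congr rfl h0, Finset.sum_const_zero] at hw
      exact absurd hw hne01
  · -- … while the right-hand sides sum to `1`
    rw [sum_range_getD, hRL, List.map_map,
      show ((T.sort (· ≤ ·)).map (bN ∘ Fin.val)) = (T.sort (· ≤ ·)).map (fun e : Fin m => bN e)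
        from rfl, sum_sort_map, Finset.sum_congr rfl (fun e _ => hbN e),
      ← hsumT (fun i => (E i).2)]
    simpa [lincomb] using hv2
  · -- the canonical clauses of the rows
    intro t ht ρ hpar
    have hi : row t < m := hRLlt _ (hrow t ht)
    have hD : Dof (2 * row t + 1) = (E ⟨row t, hi⟩).supp.map Fin.valEmbedding := by
      rw [hDr]; exact hsupN ⟨row t, hi⟩
    have hb : bN (row t) = (E ⟨row t, hi⟩).2 := hbN ⟨row t, hi⟩
    rw [hD] at hpar ⊢
    rw [hb] at hpar
    have h := map_mem_equationCNF_one (E ⟨row t, hi⟩) ρ hpar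
    simp only [sumEncoding, List.mem_flatMap, List.mem_finRange, true_and]
    exact ⟨⟨row t, hi⟩, h⟩
  · -- the counting bound
    rw [sum_range_getD (fun i => 2 ^ (Dof (2 * i + 1)).card) 0 RL, hRL, List.map_map,
      show ((T.sort (· ≤ ·)).map ((fun i => 2 ^ (Dof (2 * i + 1)).card) ∘ Fin.val)) =
        (T.sort (· ≤ ·)).map (fun e : Fin m => 2 ^ (Dof (2 * (e : ℕ) + 1)).card) from rfl,
      sum_sort_map']
    have hc : ∀ e ∈ T, 2 ^ (Dof (2 * (e : ℕ) + 1)).card = 2 ^ (E e).supp.card := by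
      intro e _
      rw [hDr, hsupN, Finset.card_map]
    rw [Finset.sum_congr rfl hc]
    exact sum_two_pow_card_supp_le E T

end Summit.PneNP.PneNP.Theorems.ModTwo
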